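import Literature.Computability.Cryptography.RegevSamplerBlocksStd
import Literature.Computability.Cryptography.RegevSamplerQFT
import Literature.Computability.QuantumComplexity.GRData
import Literature.Computability.QuantumComplexity.StageAbstract
import HarnessLib

/-!
# The register embeddings of the sampler machine on codes (Regev 2009, Lemma 3.14: uniformity, stages S3/S4)

Topic `Literature/Computability/Cryptography`; gen-11 module M3/S3–S4 (embedding part) of the sampler route for
`regev2009_lemma_3_14_stepFamily`. The Grover–Rudolph stage and the Fourier stage of the machine circuit
(`machineCircPar`: `GRStage.stageCircuit D (stdEmb I hΛ hWE)`, `QFTStage.stageCircuit (qftBlock I hΛ kF hroom) hk`) are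
one block transported to every coordinate register; by `StageAbstract.lean` their abstract gate lists are the block's
abstract list renamed by the register embeddings, so what the uniformity proof needs of the EMBEDDINGS is an explicit
`ℕ`-formula computed on codes. Both embeddings are "affine with a threshold":

* `embA off ℓ base B i w = if w < ℓ then off + (i·ℓ + w) else base + (i·B + w)`;
* `val_stdEmb_eq_embA` — `(stdEmb I hΛ hWE i q : ℕ) = embA 0 Λ.ℓ Λ.base B i q` (layouts with `loc = id`);
  `val_qftBlock_eq_embA` — `(qftBlock I hΛ kF hroom i q : ℕ) = embA Λ.oS Λ.ℓR Λ.base (qbsize Λ.ℓR kF) i q`;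
* **`map_toAG_grStage_std`**, **`map_toAG_qftStage_std`** — the two machine stages abstract to
  `(List.finRange I.n).flatMap fun i => blockA.map (AGmap (embA …  i))`;
* **`embA_codeFP`** — `embA` on codes (`CodeFP (pairE (pairE e4E natE) natE) natE`, parameters `(off, ℓ, base, B)` as four
  numerals, then `i`, then the wire), ready for `stageA_codeFP`.

No named fact is introduced.

HONEST FRAMING: the VALUE is a THEOREM (kernel-checked lemmas of a KNOWN reduction, Regev 2009) — NOT summit
progress; the trust base `{A_q14}` of `pqc.S19` is unchanged by this file.

## References

* O. Regev, *On lattices, learning with errors, random linear codes, and cryptography*, J. ACM 56(6) (2009),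
  Lemma 3.14 (proof: the same block on every register; uniformity) [Regev2009].
* S. Arora, B. Barak, *Computational Complexity: A Modern Approach*, CUP 2009, §6.2 and proof of Thm. 6.15
  [AroraBarak2009].
* M. A. Nielsen, I. L. Chuang, *Quantum Computation and Quantum Information*, CUP 2010, §4.5, §5.1 [NielsenChuang2010].
-/

noncomputable section

namespace Literature.Computability.Cryptography.Regev2009.SamplerRegs

open _root_.Computability Literature.Algebra.EuclideanLattices Literature.Algebra.EuclideanLattices.Regev2009
  Literature.Computability.QuantumComplexity Literature.Computability.QuantumComplexity.AJLCore
  Literature.Computability.Complexity Literature.Computability.Complexity.CodeFP SamplerClassical SamplerClassical.Layout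

/-! ### Affine embeddings with a threshold -/

/-- **The register embedding formula**: block wire `w` of register `i` goes to the zone position `off + (i·ℓ + w)` if
`w < ℓ` (a data wire), else to the work wire `base + (i·B + w)`. [cite: Regev2009, Lemma 3.14 (proof: the registers)] -/
def embA (off ℓ base B i w : ℕ) : ℕ := if w < ℓ then off + (i * ℓ + w) else base + (i * B + w)

section Std

variable {W : ℕ} (I : LatticeInstance) {Λ : Layout W I.n} (hΛ : Λ.OK)

/-- **The standard block embedding is `embA 0 ℓ base B`** (layouts with `loc = id`). [cite: Regev2009, Lemma 3.14 (proof)] -/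
theorem val_stdEmb_eq_embA {B : ℕ} (hWE : Λ.base + I.n * B ≤ W) (hloc : ∀ s, Λ.loc s = s) (i : Fin I.n) (q : Fin B) :
    (stdEmb I hΛ hWE i q : ℕ) = embA 0 Λ.ℓ Λ.base B i q := by
  rw [stdEmb_apply, embA]
  by_cases hq : (q : ℕ) < Λ.ℓ
  · rw [if_pos hq, Nat.zero_add]
    unfold stdEmbFun
    rw [if_pos hq]
    have hT := Λ.T_eq
    have hlt : (i : ℕ) * Λ.ℓ + q < I.n * Λ.ℓ := blk_lt i ⟨q, hq⟩
    rw [fin_val hΛ (by omega), hloc]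
  · rw [if_neg hq, stdEmbFun_val_of_le I hWE i q (Nat.not_lt.1 hq)]

/-- **The Fourier block embedding is `embA oS ℓR base (qbsize ℓR kF)`** (layouts with `loc = id`).
[cite: Regev2009, Lemma 3.14 (proof)] -/
theorem val_qftBlock_eq_embA (kF : ℕ) (hroom : Λ.base + I.n * QFTKit.qbsize Λ.ℓR kF ≤ W) (hloc : ∀ s, Λ.loc s = s)
    (i : Fin I.n) (q : Fin (QFTKit.qbsize Λ.ℓR kF)) :
    (qftBlock I hΛ kF hroom i q : ℕ) = embA Λ.oS Λ.ℓR Λ.base (QFTKit.qbsize Λ.ℓR kF) i q := by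
  rw [embA]
  by_cases hq : (q : ℕ) < Λ.ℓR
  · rw [if_pos hq, qftBlock_apply_lt I hΛ kF hroom i hq]
    have hT := Λ.T_eq
    obtain ⟨-, -, hS', hA', hT'⟩ := offs_eq I Λ
    have hlt : (i : ℕ) * Λ.ℓR + q < I.n * Λ.ℓR := blk_lt i ⟨q, hq⟩
    rw [fin_val hΛ (by omega), hloc]
  · rw [if_neg hq, qftBlock_apply_ge I hΛ kF hroom i (Nat.not_lt.1 hq)]

/-- **The Grover–Rudolph stage of the machine abstracts to the block list under `embA 0 ℓ base B`.**
[cite: Regev2009, Lemma 3.14 (proof)] [cite: AroraBarak2009, §6.2] -/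
theorem map_toAG_grStage_std {np wlen kk : ℕ} {ag : Fin Λ.ℓ → (Fin Λ.ℓ → Bool) → ℝ}
    (D : GRBlock.Data (GRData.kit Λ.ℓ np wlen kk) (GRData.ws Λ.ℓ np wlen kk) (GRData.pw Λ.ℓ np wlen kk) ag)
    (hWE : Λ.base + I.n * GRData.B Λ.ℓ np wlen kk ≤ W) (hloc : ∀ s, Λ.loc s = s) :
    (GRStage.stageCircuit D (stdEmb I hΛ hWE)).gates.map toAG =
      (List.finRange I.n).flatMap fun i : Fin I.n =>
        ((GRStage.blockCircuit D).gates.map toAG).map (AGmap (embA 0 Λ.ℓ Λ.base (GRData.B Λ.ℓ np wlen kk) (i : ℕ))) :=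
  GRStage.map_toAG_stageCircuit D _ _ fun i q => (val_stdEmb_eq_embA I hΛ hWE hloc i q).symm

/-- **The Fourier stage of the machine abstracts to the block list under `embA oS ℓR base qbsize`.**
[cite: Regev2009, Lemma 3.14 (proof)] [cite: AroraBarak2009, §6.2] -/
theorem map_toAG_qftStage_std (kF : ℕ) (hk : 1 ≤ kF) (hroom : Λ.base + I.n * QFTKit.qbsize Λ.ℓR kF ≤ W)
    (hloc : ∀ s, Λ.loc s = s) :
    (QFTStage.stageCircuit (qftBlock I hΛ kF hroom) hk).gates.map toAG =
      (List.finRange I.n).flatMap fun i : Fin I.n =>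
        ((QFTStage.block (κ := Λ.ℓR) hk).gates.map toAG).map (AGmap (embA Λ.oS Λ.ℓR Λ.base (QFTKit.qbsize Λ.ℓR kF) (i : ℕ))) :=
  QFTStage.map_toAG_stageCircuit _ hk _ fun i q => (val_qftBlock_eq_embA I hΛ kF hroom hloc i q).symm

end Std

/-! ### The embedding formula on codes -/

/-- The code of the embedding parameters `(off, ℓ, base, B)`: four numerals. [folklore] -/
abbrev e4E : ℕ × ℕ × ℕ × ℕ → List Bool := pairE natE (pairE natE (pairE natE natE))

/-- **`embA` on codes**: input `((params, i), w)`. [cite: AroraBarak2009, §6.2 and proof of Thm. 6.15] -/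
theorem embA_codeFP : CodeFP (pairE (pairE e4E natE) natE) natE
    (fun q => embA q.1.1.1 q.1.1.2.1 q.1.1.2.2.1 q.1.1.2.2.2 q.1.2 q.2) := by
  have hP : CodeFP (pairE (pairE e4E natE) natE) e4E (fun q => q.1.1) := (fst _ _).fst'
  have hi : CodeFP (pairE (pairE e4E natE) natE) natE (fun q => q.1.2) := (fst _ _).snd'
  have hw : CodeFP (pairE (pairE e4E natE) natE) natE (fun q => q.2) := snd _ _
  have hlt : CodeFP (pairE (pairE e4E natE) natE) bitE (fun q => decide (q.2 < q.1.1.2.1)) := (natLt.comp (hw.pair hP.snd'.fst') :)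
  have h1 : CodeFP (pairE (pairE e4E natE) natE) natE (fun q => q.1.1.1 + (q.1.2 * q.1.1.2.1 + q.2)) :=
    (natAdd.comp (hP.fst'.pair (natAdd.comp ((natMul.comp (hi.pair hP.snd'.fst')).pair hw))) :)
  have h2 : CodeFP (pairE (pairE e4E natE) natE) natE (fun q => q.1.1.2.2.1 + (q.1.2 * q.1.1.2.2.2 + q.2)) :=
    (natAdd.comp (hP.snd'.snd'.fst'.pair (natAdd.comp ((natMul.comp (hi.pair hP.snd'.snd'.snd')).pair hw))) :)
  exact (iteProp hlt h1 h2).congr fun _ => rfl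

/-- **`embA` with the parameters read off a context on codes** — the `hf` input of `stageA_codeFP`. [cite: AroraBarak2009, §6.2] -/
theorem embA_codeFP_of {σ : Type} {eσ : σ → List Bool} {off ℓ base B : σ → ℕ} (hoff : CodeFP eσ natE off)
    (hℓ : CodeFP eσ natE ℓ) (hbase : CodeFP eσ natE base) (hB : CodeFP eσ natE B) :
    CodeFP (pairE (pairE eσ natE) natE) natE (fun q => embA (off q.1.1) (ℓ q.1.1) (base q.1.1) (B q.1.1) q.1.2 q.2) := by
  have hp : CodeFP eσ e4E (fun c => (off c, ℓ c, base c, B c)) := hoff.pair (hℓ.pair (hbase.pair hB))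
  exact (embA_codeFP.comp (((hp.comp (fst _ _).fst').pair (fst _ _).snd').pair (snd _ _)) :)

end Literature.Computability.Cryptography.Regev2009.SamplerRegs

end
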